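import Literature.NumberTheory.Sieve.DrappeauDispersionS1Phase
import Mathlib.MeasureTheory.Measure.Haar.NormedSpace
import HarnessLib

/-!
# Drappeau 2017, §5.5: the `ξ`-integral of (5.23) (`α̂(h/W) = W∫α(Wξ)e(−hξ)dξ`)

Topic `Literature/NumberTheory/Sieve`, part of the formalisation of §5 of S. Drappeau, Proc. London
Math. Soc. (3) 114 (2017) 684–732 = arXiv:1504.05549 (Theorem 5.1 = the named fact
`Literature.NumberTheory.Sieve.Drappeau2017_theorem51`).  Everything here is PROVED; no definition
and no named fact is introduced.

§5.5 (arXiv p. 20), before (5.23): "Now we insert the definition of `α̂` as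
`α̂(h/(q₀q₁q₂)) = q₀q₁q₂ ∫_ℝ α(q₀q₁q₂ξ) e(−hξ) dξ` … and we split the sums over `q₁, q₂` into
congruence classes modulo `n₀a₂`.  We obtain
`|ℛ₁'| ≪ x^ε (n₀|a₂|)² (Mq₀/Q²) sup_{ξ ≍ Mq₀/Q²} sup_{δ_j} sup_{λ_j} ℛ₁''`."  For the tree's
normalisation (`α(m) = ψ(m/M)`, `ψ = BFI.bumpC 1 (1/2)`, Fourier transform `𝓕` of Mathlib):

* `Drappeau2017.mul_fourier_eq_integral_scaled` — `(M/W) ψ̂(Mh/W) = ∫ ψ(Wξ/M) e(−hξ) dξ`;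
* `Drappeau2017.norm_integral_le_of_support_Icc` — `|∫G| ≤ C (b − a)` for `G` vanishing off
  `[a,b]` and bounded by `C` there (the "`(Mq₀/Q²) sup_ξ`" step).

## References

* S. Drappeau, Proc. London Math. Soc. (3) 114 (2017) 684–732, arXiv:1504.05549, §5.5, (5.23).
  [cite: Drappeau2017, §5.5]
-/

noncomputable section

open Real Complex MeasureTheory
open scoped FourierTransform

namespace Literature.NumberTheory.Sieve

namespace Drappeau2017

/-- **The `ξ`-integral**: for `M, W > 0` and any `ψ`,
`(M/W) · ψ̂(Mh/W) = ∫ e(−hξ) ψ(Wξ/M) dξ` (substitute `t = Wξ/M` in Mathlib's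
`ψ̂(w) = ∫ e(−tw) ψ(t) dt`). [cite: Drappeau2017, §5.5] -/
theorem mul_fourier_eq_integral_scaled (ψ : ℝ → ℂ) {M W : ℝ} (hM : 0 < M) (hW : 0 < W) (h : ℝ) :
    ((M / W : ℝ) : ℂ) * 𝓕 ψ (M * h / W) = ∫ ξ : ℝ, (𝐞 (-(ξ * h)) : ℂ) * ψ (W * ξ / M) := by
  rw [Real.fourier_real_eq]
  have key := MeasureTheory.Measure.integral_comp_mul_left
    (fun v : ℝ => (𝐞 (-(v * (M * h / W))) : ℂ) * ψ v) (W / M)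
  have hWM : 0 < W / M := div_pos hW hM
  have e1 : (fun ξ : ℝ => (𝐞 (-(ξ * h)) : ℂ) * ψ (W * ξ / M)) =
      fun ξ : ℝ => (fun v : ℝ => (𝐞 (-(v * (M * h / W))) : ℂ) * ψ v) (W / M * ξ) := by
    funext ξ
    simp only
    congr 3
    · field_simp
    · ring
  rw [e1, key, abs_of_pos (inv_pos.2 hWM), inv_div]
  simp_rw [Circle.smul_def]
  rw [Complex.real_smul]
  simp_rw [smul_eq_mul]

/-- **`(length) · sup`**: if `G : ℝ → ℂ` vanishes outside `[a, b]` (`a ≤ b`) and `|G| ≤ C` on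
`[a, b]`, then `|∫ G| ≤ C (b − a)`. [folklore] -/
theorem norm_integral_le_of_support_Icc {G : ℝ → ℂ} {a b C : ℝ} (hab : a ≤ b)
    (hG : ∀ ξ, ξ ∉ Set.Icc a b → G ξ = 0) (hC : ∀ ξ ∈ Set.Icc a b, ‖G ξ‖ ≤ C) :
    ‖∫ ξ, G ξ‖ ≤ C * (b - a) := by
  rw [← MeasureTheory.setIntegral_eq_integral_of_forall_compl_eq_zero hG]
  have hfin : volume (Set.Icc a b) < ⊤ := by
    rw [Real.volume_Icc]; exact ENNReal.ofReal_lt_top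
  refine (MeasureTheory.norm_setIntegral_le_of_norm_le_const hfin hC).trans (le_of_eq ?_)
  rw [Measure.real, Real.volume_Icc, ENNReal.toReal_ofReal (by linarith)]

end Drappeau2017

end Literature.NumberTheory.Sieve

end
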